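import Mathlib
import Summits.NavierStokesRegularity.OSWSelfSimilar.SheetNSLineMomentSignLaw
import HarnessLib

/-!
# The gCLM/OSW MODEL velocity of an odd profile as a LOG-KERNEL integral on the half line:
# `𝒰(x) = π⁻¹ ∫₀^∞ Ω(y) log(|x−y|/(x+y)) dy`

HONEST FRAMING (cell ns-blowup GROUP B «PROFILE SEARCH», zone Z3 = the 1-D viscous gCLM/OSW sheet; human rulings
D-0035/D-0074): **a classical line-Hilbert-transform identity for odd data, kernel-checked as the first input of the
SIGN-FREE tail-sign law on the NS-type line (`SheetHalfLineVelocityPairing`, `SheetNSLineTailSign`); 1-D MODEL; not Euler,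
not Navier–Stokes; «violates: none — MODEL».**

OBJECT. `Ω : ℝ → ℝ` odd, `C¹` with `|Ω′| ≤ M` and the NS-type-line envelope `|Ω(y)| ≤ C/(1+y²)`; the MODEL velocity is the odd
`𝒰` with `𝒰′ = HΩ`, `𝒰(0) = 0` (`H = hilbertTransform`, convention `u_x = Hω`); `P = ∫₀ˣΩ` is the even primitive and
`𝒰 = HP` (`velocity_eq_hilbertTransform_prim`, `SheetHalfLineVelocitySign`).

WHAT IS PROVED (all [folklore]: the conjugate-Poisson/log-potential form of `u` for odd vorticity, e.g. Córdoba–Córdoba–Fontelos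
2005 eq. (1.4) `u(x) = π⁻¹∫₀^∞ ω(y) log(|x−y|/(x+y)) dy` for odd `ω`; no definitions):
* `logKernel_nonneg`, `logKernel_le_log_five`, `logKernel_le_near` — the kernel `log((x+y)/|x−y|) ≥ 0` on `(0,∞)²`, is
  `≤ log 5` off the cone `|y−x| < x/2`, and `≤ log(5x/2) − log|y−x|` inside it; `integral_near_majorant`:
  `∫_{x/2}^{3x/2} (log(5x/2) − log|y−x|) dy = x(1 + log 5)`;
* `integrableOn_abs_mul_logKernel`, `integral_abs_mul_logKernel_le` — **`y ↦ |Ω(y)| log((x+y)/|x−y|)` is integrable on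
  `(0,∞)` with the UNIFORM bound `∫₀^∞ |Ω(y)| log((x+y)/|x−y|) dy ≤ log 5·‖Ω‖₁ + (1 + log 5)·C`** for every `x > 0`
  (the log singularity on the diagonal costs `x(1+log 5)·sup_{[x/2,3x/2]}|Ω| ≤ (1+log 5)·C·x/(1+x²/4)`);
* `hilbertTransform_prim_eq_integral_logKernel` — **`(HP)(x) = π⁻¹∫₀^∞ Ω(y) log(|x−y|/(x+y)) dy` for `x > 0`**: with
  `P(x−t) − P(x+t) = −∫_{|t−x|}^{t+x}Ω` (evenness of `P`) the symmetric form `HP(x) = π⁻¹∫₀^∞(P(x−t)−P(x+t))/t dt` is the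
  integral of `−Ω(y)/t` over the region `{|t−x| < y < t+x} = {|y−x| < t < y+x}` of `(0,∞)²`, absolutely convergent by the
  previous bullet; Fubini and `∫_{|x−y|}^{x+y} dt/t = log((x+y)/|x−y|)`;
* `velocity_eq_integral_logKernel` — the same for the velocity `𝒰` (`𝒰′ = HΩ`, `𝒰(0) = 0`).
bears_on: LADDER-NS N5 / zone Z3 clause (i′) (CENSUS-Z3 v2.11 §0) → N1 linear core. WHAT THIS IS NOT: not NS.
-/

noncomputable section
open Set Filter Topology MeasureTheory
open scoped Real

namespace Summit.NavierStokesRegularity.OSWSelfSimilar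
namespace SheetHalfLine
open Literature.Analysis.Fourier

/-! ### The log kernel `log((x+y)/|x−y|)` on `(0,∞)²` -/

/-- `log((x+y)/|x−y|) ≥ 0` for `x, y ≥ 0` (at `y = x` the Lean value is `log 0 = 0`). [folklore] -/
theorem logKernel_nonneg {x y : ℝ} (hx : 0 ≤ x) (hy : 0 ≤ y) : 0 ≤ Real.log ((x + y) / |x - y|) := by
  rcases eq_or_ne (x - y) 0 with h0 | h0
  · simp [h0]
  · have hpos : 0 < |x - y| := abs_pos.mpr h0
    refine Real.log_nonneg ?_
    rw [le_div_iff₀ hpos, one_mul, abs_le]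
    constructor <;> linarith

/-- Off the cone `|y − x| < x/2` the kernel is at most `log 5`: `x + y ≤ 5|x − y|`. [folklore] -/
theorem logKernel_le_log_five {x y : ℝ} (hx : 0 < x) (hy : 0 ≤ y) (hfar : x / 2 ≤ |y - x|) :
    Real.log ((x + y) / |x - y|) ≤ Real.log 5 := by
  have hpos : 0 < |x - y| := by rw [abs_sub_comm]; linarith
  refine Real.log_le_log (div_pos (by linarith) hpos) ?_
  rw [div_le_iff₀ hpos, abs_sub_comm]
  have h1 : y ≤ x + |y - x| := by
    have := le_abs_self (y - x); linarith
  linarith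

/-- Inside the cone `|y − x| < x/2`, `y ≠ x`: `log((x+y)/|x−y|) ≤ log(5x/2) − log|y − x|`. [folklore] -/
theorem logKernel_le_near {x y : ℝ} (hnear : |y - x| < x / 2) (hne : y ≠ x) :
    Real.log ((x + y) / |x - y|) ≤ Real.log (5 * x / 2) - Real.log |y - x| := by
  have hpos : 0 < |y - x| := abs_pos.mpr (sub_ne_zero.mpr hne)
  have hy : y < 3 * x / 2 := by
    have := le_abs_self (y - x); linarith
  rw [abs_sub_comm, Real.log_div (by linarith [neg_abs_le (y - x), abs_nonneg (y - x)]) hpos.ne']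
  have hxy : 0 < x + y := by
    have := neg_abs_le (y - x); linarith
  linarith [Real.log_le_log hxy (show x + y ≤ 5 * x / 2 by linarith)]

/-- `∫_{x/2}^{3x/2} (log(5x/2) − log|y − x|) dy = x(1 + log 5)` (`∫₋ₕʰ log|u| du = 2(h log h − h)`). [folklore] -/
theorem integral_near_majorant {x : ℝ} (hx : 0 < x) :
    ∫ y in (x / 2)..(3 * x / 2), (Real.log (5 * x / 2) - Real.log |y - x|) = x * (1 + Real.log 5) := by
  have hlog : IntervalIntegrable (fun y => Real.log |y - x|) volume (x / 2) (3 * x / 2) := by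
    have h := (intervalIntegral.intervalIntegrable_log' (a := x / 2 - x) (b := 3 * x / 2 - x)).comp_sub_right x
    simp only [sub_add_cancel] at h
    refine h.congr ?_  -- log (y - x) = log |y - x|
    exact fun y _ => (Real.log_abs _).symm
  rw [intervalIntegral.integral_sub intervalIntegrable_const hlog, intervalIntegral.integral_const, smul_eq_mul]
  have h2 : ∫ y in (x / 2)..(3 * x / 2), Real.log |y - x| = x * Real.log (x / 2) - x := by
    have hs := intervalIntegral.integral_comp_sub_right (fun u => Real.log |u|) (a := x / 2) (b := 3 * x / 2) x
    rw [hs, show x / 2 - x = -(x / 2) by ring, show 3 * x / 2 - x = x / 2 by ring]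
    simp_rw [Real.log_abs]
    rw [integral_log, Real.log_neg_eq_log]
    ring
  rw [h2, show 5 * x / 2 = 5 * (x / 2) by ring, Real.log_mul (by norm_num) (by positivity)]
  ring


/-! ### `y ↦ |Ω(y)|·log((x+y)/|x−y|)` is integrable on `(0,∞)`, uniformly in `x` -/

/-- Envelope ⇒ `|Ω| ≤ C`. [folklore] -/
theorem abs_le_const_of_env {Om : ℝ → ℝ} {C : ℝ} (hC : ∀ y, |Om y| ≤ C / (1 + y ^ 2)) (y : ℝ) : |Om y| ≤ C :=
  (hC y).trans (div_le_self (env_const_nonneg hC) (by nlinarith [sq_nonneg y]))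

/-- The near-diagonal pointwise bound: for `y ∈ (x/2, 3x/2)`, `y ≠ x`,
`|Ω(y)| log((x+y)/|x−y|) ≤ (C/(1+(x/2)²))·(log(5x/2) − log|y−x|)`. [folklore] -/
theorem abs_mul_logKernel_le_near {Om : ℝ → ℝ} {C : ℝ} (hC : ∀ y, |Om y| ≤ C / (1 + y ^ 2)) {x y : ℝ} (hx : 0 < x)
    (hy : y ∈ Ioo (x / 2) (3 * x / 2)) (hne : y ≠ x) :
    |Om y| * Real.log ((x + y) / |x - y|) ≤ C / (1 + (x / 2) ^ 2) * (Real.log (5 * x / 2) - Real.log |y - x|) := by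
  have hC0 : 0 ≤ C := env_const_nonneg hC
  have hnear : |y - x| < x / 2 := by rw [abs_lt]; constructor <;> linarith [hy.1, hy.2]
  have hK := logKernel_le_near hnear hne
  have hK0 : 0 ≤ Real.log ((x + y) / |x - y|) := logKernel_nonneg hx.le (by linarith [hy.1])
  have hΩ : |Om y| ≤ C / (1 + (x / 2) ^ 2) := by
    refine (hC y).trans (div_le_div_of_nonneg_left hC0 (by positivity) ?_)
    nlinarith [hy.1]
  exact mul_le_mul hΩ hK hK0 (by positivity)

/-- The near-diagonal majorant is integrable on `(x/2, 3x/2)`. [folklore] -/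
theorem integrableOn_near_majorant (x c : ℝ) :
    IntegrableOn (fun y => c * (Real.log (5 * x / 2) - Real.log |y - x|)) (Ioo (x / 2) (3 * x / 2)) := by
  have hlog : IntervalIntegrable (fun y => Real.log |y - x|) volume (x / 2) (3 * x / 2) := by
    have h := (intervalIntegral.intervalIntegrable_log' (a := x / 2 - x) (b := 3 * x / 2 - x)).comp_sub_right x
    simp only [sub_add_cancel] at h
    exact h.congr fun y _ => (Real.log_abs _).symm
  have h1 : IntervalIntegrable (fun y => c * (Real.log (5 * x / 2) - Real.log |y - x|)) volume (x / 2) (3 * x / 2) :=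
    (intervalIntegrable_const.sub hlog).const_mul c
  rcases le_or_gt (x / 2) (3 * x / 2) with hle | hgt
  · exact ((intervalIntegrable_iff_integrableOn_Ioc_of_le hle).mp h1).mono_set Ioo_subset_Ioc_self
  · rw [Ioo_eq_empty (by intro h; linarith [h])]
    exact integrableOn_empty

/-- **`y ↦ |Ω(y)| log((x+y)/|x−y|)` is integrable on `(0,∞)`** for continuous `Ω` with `|Ω(y)| ≤ C/(1+y²)`, `x > 0`:
off the cone `|y−x| < x/2` the kernel is `≤ log 5` and `Ω ∈ L¹`; inside, `|Ω| ≤ C/(1+(x/2)²)` and the log is integrable.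
[folklore] -/
theorem integrableOn_abs_mul_logKernel {Om : ℝ → ℝ} {C : ℝ} (hc : Continuous Om)
    (hC : ∀ y, |Om y| ≤ C / (1 + y ^ 2)) {x : ℝ} (hx : 0 < x) :
    IntegrableOn (fun y => |Om y| * Real.log ((x + y) / |x - y|)) (Ioi 0) := by
  have hm : Measurable (fun y => |Om y| * Real.log ((x + y) / |x - y|)) :=
    hc.measurable.abs.mul (((measurable_const.add measurable_id).div
      (measurable_const.sub measurable_id).abs).log)
  have hΩi : Integrable Om := integrable_of_env hc hC
  set A : Set ℝ := {y | 0 < y ∧ x / 2 ≤ |y - x|} with hA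
  set B : Set ℝ := Ioo (x / 2) (3 * x / 2) with hB
  have hAB : Ioi (0:ℝ) ⊆ A ∪ B := by
    intro y hy
    by_cases h : x / 2 ≤ |y - x|
    · exact Or.inl ⟨hy, h⟩
    · right
      rw [not_le, abs_lt] at h
      exact ⟨by linarith [h.1], by linarith [h.2]⟩
  have hAm : MeasurableSet A :=
    (measurableSet_lt measurable_const measurable_id).inter
      (measurableSet_le measurable_const ((measurable_id.sub measurable_const).abs))
  refine IntegrableOn.mono_set (IntegrableOn.union ?_ ?_) hAB
  · -- far piece
    refine Integrable.mono' ((hΩi.abs.const_mul (Real.log 5)).restrict (s := A)) hm.aestronglyMeasurable.restrict ?_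
    refine (ae_restrict_iff' hAm).mpr (Eventually.of_forall fun y hy => ?_)
    rw [Real.norm_eq_abs, abs_of_nonneg (mul_nonneg (abs_nonneg _) (logKernel_nonneg hx.le hy.1.le)), mul_comm (Real.log 5)]
    exact mul_le_mul_of_nonneg_left (logKernel_le_log_five hx hy.1.le hy.2) (abs_nonneg _)
  · -- near piece
    refine Integrable.mono' (integrableOn_near_majorant x (C / (1 + (x / 2) ^ 2))) hm.aestronglyMeasurable.restrict ?_
    have hne : ∀ᵐ y ∂(volume.restrict B), y ∉ ({x} : Set ℝ) := (Set.countable_singleton x).ae_notMem _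
    filter_upwards [ae_restrict_mem measurableSet_Ioo, hne] with y hy hyx
    rw [Real.norm_eq_abs, abs_of_nonneg (mul_nonneg (abs_nonneg _) (logKernel_nonneg hx.le (by linarith [hy.1])))]
    exact abs_mul_logKernel_le_near hC hx hy hyx

/-- **UNIFORM BOUND**: `∫₀^∞ |Ω(y)| log((x+y)/|x−y|) dy ≤ log 5·∫|Ω| + (1 + log 5)·C` for every `x > 0`. [folklore] -/
theorem integral_abs_mul_logKernel_le {Om : ℝ → ℝ} {C : ℝ} (hc : Continuous Om)
    (hC : ∀ y, |Om y| ≤ C / (1 + y ^ 2)) {x : ℝ} (hx : 0 < x) :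
    ∫ y in Ioi 0, |Om y| * Real.log ((x + y) / |x - y|)
      ≤ Real.log 5 * (∫ y, |Om y|) + (1 + Real.log 5) * C := by
  have hC0 : 0 ≤ C := env_const_nonneg hC
  have hΩi : Integrable Om := integrable_of_env hc hC
  have hint := integrableOn_abs_mul_logKernel hc hC hx
  set g : ℝ → ℝ := fun y => |Om y| * Real.log ((x + y) / |x - y|) with hg
  set A : Set ℝ := {y | 0 < y ∧ x / 2 ≤ |y - x|} with hA
  set B : Set ℝ := Ioo (x / 2) (3 * x / 2) with hB
  have hsplit : Ioi (0:ℝ) = A ∪ B := by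
    ext y
    constructor
    · intro hy
      by_cases h : x / 2 ≤ |y - x|
      · exact Or.inl ⟨hy, h⟩
      · right
        rw [not_le, abs_lt] at h
        exact ⟨by linarith [h.1], by linarith [h.2]⟩
    · rintro (hy | hy)
      · exact hy.1
      · exact lt_trans (by linarith : (0:ℝ) < x / 2) hy.1
  have hdisj : Disjoint A B := by
    rw [Set.disjoint_left]
    intro y hyA hyB
    have : |y - x| < x / 2 := by rw [abs_lt]; constructor <;> linarith [hyB.1, hyB.2]
    linarith [hyA.2]
  have hgA : IntegrableOn g A := hint.mono_set (hsplit ▸ subset_union_left)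
  have hgB : IntegrableOn g B := hint.mono_set (hsplit ▸ subset_union_right)
  rw [hsplit, setIntegral_union hdisj measurableSet_Ioo hgA hgB]
  have hg0 : ∀ y, 0 < y → 0 ≤ g y := fun y hy => mul_nonneg (abs_nonneg _) (logKernel_nonneg hx.le hy.le)
  -- far piece
  have hfar : ∫ y in A, g y ≤ Real.log 5 * ∫ y, |Om y| := by
    have hAm : MeasurableSet A :=
      (measurableSet_lt measurable_const measurable_id).inter
        (measurableSet_le measurable_const ((measurable_id.sub measurable_const).abs))
    calc ∫ y in A, g y ≤ ∫ y in A, Real.log 5 * |Om y| := by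
          refine setIntegral_mono_on hgA ((hΩi.abs.const_mul _).integrableOn) hAm fun y hy => ?_
          rw [hg, mul_comm (Real.log 5)]
          exact mul_le_mul_of_nonneg_left (logKernel_le_log_five hx hy.1.le hy.2) (abs_nonneg _)
      _ ≤ ∫ y, Real.log 5 * |Om y| := by
          refine setIntegral_le_integral (hΩi.abs.const_mul _) (Eventually.of_forall fun y => ?_)
          exact mul_nonneg (Real.log_nonneg (by norm_num)) (abs_nonneg _)
      _ = Real.log 5 * ∫ y, |Om y| := integral_const_mul _ _
  -- near piece
  have hnear : ∫ y in B, g y ≤ (1 + Real.log 5) * C := by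
    have hmaj := integrableOn_near_majorant x (C / (1 + (x / 2) ^ 2))
    have h1 : ∫ y in B, g y ≤ ∫ y in B, C / (1 + (x / 2) ^ 2) * (Real.log (5 * x / 2) - Real.log |y - x|) := by
      refine integral_mono_ae hgB hmaj ?_
      have hne : ∀ᵐ y ∂(volume.restrict B), y ∉ ({x} : Set ℝ) := (Set.countable_singleton x).ae_notMem _
      filter_upwards [ae_restrict_mem measurableSet_Ioo, hne] with y hy hyx
      exact abs_mul_logKernel_le_near hC hx hy hyx
    have h2 : ∫ y in B, C / (1 + (x / 2) ^ 2) * (Real.log (5 * x / 2) - Real.log |y - x|)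
        = C / (1 + (x / 2) ^ 2) * (x * (1 + Real.log 5)) := by
      rw [hB, ← integral_Ioc_eq_integral_Ioo, ← intervalIntegral.integral_of_le (by linarith),
        intervalIntegral.integral_const_mul, integral_near_majorant hx]
    have h3 : C / (1 + (x / 2) ^ 2) * (x * (1 + Real.log 5)) ≤ (1 + Real.log 5) * C := by
      have hl5 : 0 ≤ Real.log 5 := Real.log_nonneg (by norm_num)
      rw [div_mul_eq_mul_div, div_le_iff₀ (by positivity)]
      nlinarith [sq_nonneg (x / 2 - 1), mul_nonneg hC0 hl5]
    linarith
  linarith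

/-! ### `HP(x) = π⁻¹ ∫₀^∞ Ω(y) log(|x−y|/(x+y)) dy` -/

/-- `∫_{|x−y|}^{x+y} dt/t = log((x+y)/|x−y|)` (`x, y ≥ 0`, `y ≠ x`). [folklore] -/
theorem integral_Ioo_inv_eq_logKernel {x y : ℝ} (hx : 0 ≤ x) (hy : 0 ≤ y) (hne : y ≠ x) :
    ∫ t in Ioo |x - y| (x + y), t⁻¹ = Real.log ((x + y) / |x - y|) := by
  have hpos : 0 < |x - y| := abs_pos.mpr (sub_ne_zero.mpr (Ne.symm hne))
  have hle : |x - y| ≤ x + y := by rw [abs_le]; constructor <;> linarith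
  rw [← integral_Ioc_eq_integral_Ioo, ← intervalIntegral.integral_of_le hle,
    integral_inv_of_pos hpos (lt_of_lt_of_le hpos hle)]

/-- `P(x − t) − P(x + t) = −∫_{|t−x|}^{t+x} Ω` for the even primitive `P = ∫₀Ω` of an odd `Ω`. [folklore] -/
theorem prim_symm_eq_abs {Om : ℝ → ℝ} (hc : Continuous Om) (hodd : ∀ y, Om (-y) = -Om y) (x t : ℝ) :
    (∫ u in (0:ℝ)..(x - t), Om u) - (∫ u in (0:ℝ)..(x + t), Om u) = -∫ u in |t - x|..(t + x), Om u := by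
  have habs : (∫ u in (0:ℝ)..(x - t), Om u) = ∫ u in (0:ℝ)..|t - x|, Om u := by
    rcases le_or_gt x t with h | h
    · rw [abs_of_nonneg (by linarith : 0 ≤ t - x), show x - t = -(t - x) by ring, prim_even hodd]
    · rw [abs_of_neg (by linarith : t - x < 0), neg_sub]
  have hsub : (∫ u in (0:ℝ)..(t + x), Om u) - (∫ u in (0:ℝ)..|t - x|, Om u) = ∫ u in |t - x|..(t + x), Om u :=
    intervalIntegral.integral_interval_sub_left (hc.intervalIntegrable _ _) (hc.intervalIntegrable _ _)
  rw [habs, add_comm x t]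
  linarith

/-- **`(HP)(x) = π⁻¹ ∫₀^∞ Ω(y) log(|x−y|/(x+y)) dy` for `x > 0`**, `P = ∫₀Ω`, `Ω` odd continuous with `|Ω(y)| ≤ C/(1+y²)`:
the symmetric form `π⁻¹∫₀^∞ (P(x−t) − P(x+t))/t dt` is `−π⁻¹ ∬_{|t−x|<y<t+x} Ω(y)/t`, absolutely convergent on `(0,∞)²`
(`integrableOn_abs_mul_logKernel`), and `{|t−x| < y < t+x} = {|y−x| < t < y+x}` with `∫_{|x−y|}^{x+y} dt/t = log((x+y)/|x−y|)`.
[folklore] -/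
theorem hilbertTransform_prim_eq_integral_logKernel {Om : ℝ → ℝ} {C : ℝ} (hc : Continuous Om)
    (hodd : ∀ y, Om (-y) = -Om y) (hC : ∀ y, |Om y| ≤ C / (1 + y ^ 2)) {x : ℝ} (hx : 0 < x) :
    hilbertTransform (fun x => ∫ u in (0:ℝ)..x, Om u) x
      = π⁻¹ * ∫ y in Ioi (0:ℝ), Om y * Real.log (|x - y| / (x + y)) := by
  set P : ℝ → ℝ := fun x => ∫ u in (0:ℝ)..x, Om u with hP
  set μ : Measure ℝ := volume.restrict (Ioi (0:ℝ)) with hμ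
  have hΩm : Measurable Om := hc.measurable
  -- the region and the integrand
  set D : Set (ℝ × ℝ) := {p | |p.1 - x| < p.2 ∧ p.2 < p.1 + x} with hD
  have hDm : MeasurableSet D :=
    (measurableSet_lt ((measurable_fst.sub measurable_const).abs) measurable_snd).inter
      (measurableSet_lt measurable_snd (measurable_fst.add measurable_const))
  set Φ : ℝ × ℝ → ℝ := D.indicator (fun p => Om p.2 / p.1) with hΦ
  have hΦm : Measurable Φ := ((hΩm.comp measurable_snd).div measurable_fst).indicator hDm
  -- sections
  have hsec_t : ∀ y t, Φ (t, y) = (Ioo |x - y| (x + y)).indicator (fun t => Om y / t) t := by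
    intro y t
    simp only [hΦ, Set.indicator_apply, hD, mem_setOf_eq, mem_Ioo]
    have e : (|t - x| < y ∧ y < t + x) ↔ (|x - y| < t ∧ t < x + y) := by
      rw [abs_lt, abs_lt]
      constructor <;> rintro ⟨⟨h1, h2⟩, h3⟩ <;> exact ⟨⟨by linarith, by linarith⟩, by linarith⟩
    by_cases h : |t - x| < y ∧ y < t + x
    · rw [if_pos h, if_pos (e.mp h)]
    · rw [if_neg h, if_neg (fun h' => h (e.mpr h'))]
  have hsec_y : ∀ t y, Φ (t, y) = (Ioo |t - x| (t + x)).indicator (fun y => Om y / t) y := by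
    intro t y
    simp only [hΦ, Set.indicator_apply, hD, mem_setOf_eq, mem_Ioo]
  -- values of the t-sections (y > 0, y ≠ x)
  have hIoo_sub : ∀ a b : ℝ, 0 ≤ a → Ioi (0:ℝ) ∩ Ioo a b = Ioo a b := fun a b ha => by
    ext t; simp only [mem_inter_iff, mem_Ioi, mem_Ioo]
    constructor
    · exact fun h => h.2
    · exact fun h => ⟨lt_of_le_of_lt ha h.1, h⟩
  have hval_t : ∀ y, 0 < y → y ≠ x → ∫ t, Φ (t, y) ∂μ = Om y * Real.log ((x + y) / |x - y|) := by
    intro y hy hne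
    simp_rw [hsec_t y]
    rw [hμ, setIntegral_indicator measurableSet_Ioo, hIoo_sub _ _ (abs_nonneg _)]
    have e : ∀ t ∈ Ioo |x - y| (x + y), Om y / t = Om y * t⁻¹ := fun t _ => div_eq_mul_inv _ _
    rw [setIntegral_congr_fun measurableSet_Ioo e, integral_const_mul, integral_Ioo_inv_eq_logKernel hx.le hy.le hne]
  have hnorm_t : ∀ y, 0 < y → y ≠ x → ∫ t, ‖Φ (t, y)‖ ∂μ = |Om y| * Real.log ((x + y) / |x - y|) := by
    intro y hy hne
    simp_rw [hsec_t y, norm_indicator_eq_indicator_norm]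
    rw [hμ, setIntegral_indicator measurableSet_Ioo, hIoo_sub _ _ (abs_nonneg _)]
    have e : ∀ t ∈ Ioo |x - y| (x + y), ‖Om y / t‖ = |Om y| * t⁻¹ := by
      intro t ht
      have ht0 : 0 < t := lt_of_le_of_lt (abs_nonneg _) ht.1
      rw [Real.norm_eq_abs, abs_div, abs_of_pos ht0, div_eq_mul_inv]
    rw [setIntegral_congr_fun measurableSet_Ioo e, integral_const_mul, integral_Ioo_inv_eq_logKernel hx.le hy.le hne]
  -- integrability of the t-sections (y ≠ x)
  have hint_t : ∀ y, 0 < y → y ≠ x → Integrable (fun t => Φ (t, y)) μ := by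
    intro y hy hne
    have hpos : 0 < |x - y| := abs_pos.mpr (sub_ne_zero.mpr (Ne.symm hne))
    have h1 : IntegrableOn (fun t => Om y / t) (Ioo |x - y| (x + y)) := by
      refine (ContinuousOn.integrableOn_Icc ?_).mono_set Ioo_subset_Icc_self
      exact (continuousOn_const.div continuousOn_id fun t ht => (lt_of_lt_of_le hpos ht.1).ne')
    have h2 : Integrable ((Ioo |x - y| (x + y)).indicator fun t => Om y / t) volume :=
      (integrable_indicator_iff measurableSet_Ioo).mpr h1
    refine (h2.restrict (s := Ioi 0)).congr (Eventually.of_forall fun t => ?_)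
    exact (hsec_t y t).symm
  -- values of the y-sections (t > 0)
  have hval_y : ∀ t, 0 < t → ∫ y, Φ (t, y) ∂μ = -((P (x - t) - P (x + t)) / t) := by
    intro t ht
    simp_rw [hsec_y t]
    rw [hμ, setIntegral_indicator measurableSet_Ioo, hIoo_sub _ _ (abs_nonneg _)]
    have hle : |t - x| ≤ t + x := by rw [abs_le]; constructor <;> linarith
    simp_rw [div_eq_inv_mul]
    rw [integral_const_mul, ← integral_Ioc_eq_integral_Ioo, ← intervalIntegral.integral_of_le hle,
      prim_symm_eq_abs hc hodd x t]
    ring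
  -- Φ is integrable on (0,∞)²
  have hyx : ∀ᵐ y ∂μ, y ∉ ({x} : Set ℝ) := (Set.countable_singleton x).ae_notMem _
  have hy0 : ∀ᵐ y ∂μ, 0 < y := ae_restrict_mem measurableSet_Ioi
  have hΦi : Integrable Φ (μ.prod μ) := by
    rw [integrable_prod_iff' hΦm.aestronglyMeasurable]
    constructor
    · filter_upwards [hy0, hyx] with y hy hne
      exact hint_t y hy hne
    · refine (integrableOn_abs_mul_logKernel hc hC hx).congr ?_
      filter_upwards [hy0, hyx] with y hy hne
      exact (hnorm_t y hy hne).symm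
  -- Fubini both ways
  have hI1 : ∫ p, Φ p ∂(μ.prod μ) = -∫ t in Ioi (0:ℝ), (P (x - t) - P (x + t)) / t := by
    rw [integral_prod _ hΦi, ← integral_neg]
    refine integral_congr_ae ?_
    filter_upwards [hy0] with t ht
    exact hval_y t ht
  have hI2 : ∫ p, Φ p ∂(μ.prod μ) = ∫ y in Ioi (0:ℝ), Om y * Real.log ((x + y) / |x - y|) := by
    rw [integral_prod_symm _ hΦi]
    refine integral_congr_ae ?_
    filter_upwards [hy0, hyx] with y hy hne
    exact hval_t y hy hne
  have hH : hilbertTransform P x = π⁻¹ * ∫ t in Ioi (0:ℝ), (P (x - t) - P (x + t)) / t := rfl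
  rw [hH, show (∫ t in Ioi (0:ℝ), (P (x - t) - P (x + t)) / t) = -∫ p, Φ p ∂(μ.prod μ) by rw [hI1, neg_neg],
    hI2, ← integral_neg]
  congr 1
  refine integral_congr_ae (Eventually.of_forall fun y => ?_)
  simp only
  rw [← inv_div, Real.log_inv]
  ring

/-- **`𝒰(x) = π⁻¹ ∫₀^∞ Ω(y) log(|x−y|/(x+y)) dy` for `x > 0`** — the MODEL velocity (`𝒰′ = HΩ`, `𝒰(0) = 0`) of an odd `C¹`
profile with `|Ω′| ≤ M`, `|Ω(y)| ≤ C/(1+y²)`, as a log-kernel integral (`𝒰 = HP`, `velocity_eq_hilbertTransform_prim`).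
[folklore] -/
theorem velocity_eq_integral_logKernel {Om dOm U : ℝ → ℝ} {M C : ℝ} (hodd : ∀ y, Om (-y) = -Om y)
    (hOm : ∀ ξ, HasDerivAt Om (dOm ξ) ξ) (hdOmc : Continuous dOm) (hM : ∀ y, |dOm y| ≤ M)
    (hC : ∀ y, |Om y| ≤ C / (1 + y ^ 2))
    (hU : ∀ ξ, HasDerivAt U (hilbertTransform Om ξ) ξ) (hU0 : U 0 = 0) {x : ℝ} (hx : 0 < x) :
    U x = π⁻¹ * ∫ y in Ioi (0:ℝ), Om y * Real.log (|x - y| / (x + y)) := by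
  have hc : Continuous Om := continuous_iff_continuousAt.mpr fun y => (hOm y).continuousAt
  rw [velocity_eq_hilbertTransform_prim hodd hOm hdOmc hM hC hU hU0 x]
  exact hilbertTransform_prim_eq_integral_logKernel hc hodd hC hx

end SheetHalfLine
end Summit.NavierStokesRegularity.OSWSelfSimilar
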